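import Summits.KontsevichZagierPeriods.KontsevichZagierPeriods.Theses.K2SymbolChains
import Literature.NumberTheory.Transcendental.KZLogCalculusProofs

/-!
# `GenericDifferentiability` (stmt-KontsevichZagierPeriods-17757, route K2SymbolChains) — proof

`GenericDifferentiability` — GENERIC DIFFERENTIABILITY OF `ℚ`-SEMIALGEBRAIC FUNCTIONS (split child 3
of the crux `JensenMove`, stmt-KontsevichZagierPeriods-5199): for a `ℚ`-semialgebraic `τ ⊆ ℝⁿ` and
a `ℚ`-semialgebraic function `f` on `τ` there is a `ℚ`-semialgebraic `B ⊆ τ` with `τ ∖ B`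
Lebesgue-null such that `f` (as a function on `ℝⁿ`) is differentiable at every point of `B`.

Proof (the crux-strategist's sorry-free line `Cruxes/JensenMove/Lines/jensen_move_complete.lean`,
generic-differentiability part, re-homed under `Theorems/` by lead c10 of crux
stmt-KontsevichZagierPeriods-9129, banking; statements and proofs verbatim):
* `interior_conull` — `interior τ` is `ℚ`-semialgebraic (`isSemialgebraic_interior`,
  BCR Prop. 2.2.2) and `τ ∖ interior τ` is a `ℚ`-semialgebraic set with empty interior, hence
  null (`KZ.volume_eq_zero_of_interior_eq_empty`, BCR §2.8);
* `genericDifferentiability` — on the open set `interior τ` the function `f` is `C^∞` off a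
  `ℚ`-semialgebraic `Z` with empty interior and `interior τ ∖ Z` open (the tree's
  piecewise-smoothness theorem `IsSemialgebraicFunOn.exists_contDiffOn_holds`, BCR §2.9);
  `Z` is null and `B = interior τ ∖ Z` does it.
No new definitions. [Bochnak–Coste–Roy 1998, §§2.2, 2.8, 2.9] [folklore]
-/

noncomputable section

open MeasureTheory Set
open Literature.NumberTheory.Transcendental Literature.ModelTheory.ExponentialFields

namespace Summit.KontsevichZagierPeriods.K2SymbolChains

namespace GenericDifferentiabilityProof

/-- For a `ℚ`-semialgebraic `τ`, `interior τ` is `ℚ`-semialgebraic and `τ ∖ interior τ` is null.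
[BCR 1998, Prop. 2.2.2, §2.8] [folklore] -/
theorem interior_conull {n : ℕ} {τ : Set (Fin n → ℝ)} (hτ : IsSemialgebraic ℚ τ) :
    IsSemialgebraic ℚ (interior τ) ∧ volume (τ \ interior τ) = 0 := by
  have hU : IsSemialgebraic ℚ (interior τ) := isSemialgebraic_interior hτ
  refine ⟨hU, KZ.volume_eq_zero_of_interior_eq_empty (hτ.diff hU) ?_⟩
  apply Set.eq_empty_iff_forall_notMem.2
  intro x hx
  have h1 : x ∈ interior τ := interior_mono sdiff_subset hx
  have h2 : x ∈ τ \ interior τ := interior_subset hx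
  exact h2.2 h1

/-- **Generic differentiability of `ℚ`-semialgebraic functions** (the statement of route item
`K2SymbolChains.GenericDifferentiability`, spelled out). [BCR 1998, §2.9] [folklore] -/
theorem genericDifferentiability :
    ∀ (n : ℕ) (τ : Set (Fin n → ℝ)) (f : (Fin n → ℝ) → ℝ), Literature.ModelTheory.ExponentialFields.IsSemialgebraic ℚ τ → Literature.NumberTheory.Transcendental.IsSemialgebraicFunOn ℚ τ f → ∃ B : Set (Fin n → ℝ), B ⊆ τ ∧ Literature.ModelTheory.ExponentialFields.IsSemialgebraic ℚ B ∧ MeasureTheory.volume (τ \ B) = 0 ∧ ∀ x ∈ B, DifferentiableAt ℝ f x := by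
  intro n τ f hτ hf
  obtain ⟨hU, hU0⟩ := interior_conull hτ
  have hfU : IsSemialgebraicFunOn ℚ (interior τ) f := hf.mono interior_subset hU
  obtain ⟨Z, hZU, hZ, hZint, hopen, hC⟩ :=
    IsSemialgebraicFunOn.exists_contDiffOn_holds (k := ℚ) (s := interior τ) (f := f) isOpen_interior hfU
  have hZ0 : volume Z = 0 := KZ.volume_eq_zero_of_interior_eq_empty hZ hZint
  refine ⟨interior τ \ Z, fun x hx => interior_subset hx.1, hU.diff hZ, ?_, fun x hx => ?_⟩
  · refine measure_mono_null (fun x hx => ?_) (measure_union_null hU0 hZ0)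
    rcases hx with ⟨hxτ, hxB⟩
    by_cases hxU : x ∈ interior τ
    · right; by_contra hxZ; exact hxB ⟨hxU, hxZ⟩
    · left; exact ⟨hxτ, hxU⟩
  · exact ((hC.contDiffAt (hopen.mem_nhds hx)).differentiableAt (by simp))

end GenericDifferentiabilityProof

open GenericDifferentiabilityProof in
/-- **`GenericDifferentiability`** (route K2SymbolChains, stmt-KontsevichZagierPeriods-17757): for a
`ℚ`-semialgebraic `τ ⊆ ℝⁿ` and a `ℚ`-semialgebraic `f` on `τ` there is a `ℚ`-semialgebraic `B ⊆ τ`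
of full measure in `τ` at every point of which `f` is differentiable. Proof:
`genericDifferentiability` (`B = interior τ ∖ Z`, `Z` the thin singular set of
`IsSemialgebraicFunOn.exists_contDiffOn_holds`; the frontier part `τ ∖ interior τ` and `Z` are
semialgebraic with empty interior, hence null). [Bochnak–Coste–Roy 1998, §§2.2, 2.8, 2.9]
[folklore] -/
theorem genericDifferentiability_proof :
    Summit.KontsevichZagierPeriods.KontsevichZagierPeriods.Theses.K2SymbolChains.GenericDifferentiability :=
  genericDifferentiability

end Summit.KontsevichZagierPeriods.K2SymbolChains
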